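import Summits.QuantumFields.YangMills.Theorems.BalabanUVNodesN12FlatLinAvgRightInverseUniform
import HarnessLib

/-!
# BalabanUVNodes ∕ N12 — (J-b) module H12c: THE LETTER OF module H12b IS ORDER-SHARP — every right inverse of the true one-step linearisation `linAvg = L•Q − dλ̄` costs at least `L^{d−2}` on
# the unit datum of one direction: `linAvg Y = 𝟙_{dir = μ₀}·E₀ ⟹ L^d·|T^{(j+1)}| ≤ L²·Σ_b ‖Y(b)‖²` (`E₀` a matrix unit, `Σ_c ‖v(c)‖² = |T^{(j+1)}|`), i.e. `Σ‖Y‖² ≥ L^{d−2}·Σ‖v‖²`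

Cell `pub-ymgap` (HUMAN RULINGS D-0062 ∕ D-0149), width seat `pub-ymgap-dag-n10-w1` g5 (modules H8–H12b of this session).  `--kind proof --supports stmt-QuantumFields-27364 --as helper` (K1⁹, KEY MAP v2);
count-neutral; THEOREMS ONLY (0 `def`, 0 `sorry`, 0 `instance`, 0 `notation`).

THE PAIRING.  Test against the indicator `w = 𝟙_{dir = μ₀}` of the coarse `μ₀`-bonds in the real `(i₀,i₀)`-component: by UST's `linAvg_eq_bondAvg_sub_grad_combMean`,
`Σ_c w(c)·re(linAvg Y(c))_{i₀i₀} = L·Σ_c w(c)·Q(re Y_{i₀i₀})(c) − Σ_c w(c)·(re λ̄(c₊)_{i₀i₀} − re λ̄(c₋)_{i₀i₀})`; the comb term telescopes to `0` along each `μ₀`-line of the coarse torus (the indicator is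
divergence-free), and `Σ_c w(c)·(QX)(c) = Σ_b (Qᵗw)(b)·X(b)` with the tent kernel of module H8 giving `(Qᵗw)(b) = L^{−d}·𝟙_{dir b = μ₀}` (both end weights of the tent see the same value `1`).
Hence for `linAvg Y = w·E₀`: `|T^{(j+1)}| = L^{1−d}·Σ_{dir b = μ₀} re Y(b)_{i₀i₀} ≤ L^{1−d}·√(L^d|T^{(j+1)}|)·√(Σ_b‖Y b‖²)` (Cauchy–Schwarz over the `L^d|T^{(j+1)}|` fine `μ₀`-bonds, `|re z| ≤ ‖A‖` for an
entry `z` of `A`), i.e. `L^d·|T^{(j+1)}| ≤ L²·Σ_b‖Y b‖²`.  The obvious preimage `Y = L⁻¹·𝟙_{dir = μ₀}·E₀` attains it (not typed).  So module H12b's `|n|(6L^d∕(L²+2) + 288d(d+2)²)` is of the right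
order `L^{d−2}` in `L` (η-units: `Θ(1)`), as print's (46) asserts.

CONTENTS (ns `Summit.QuantumFields.YangMills.BalabanUVNodes.N12FlatLinAvgLetterFloor`).  §1 `sum_kernel_indicator_dir` (`Qᵗ𝟙_{μ₀} = L^{−d}𝟙_{μ₀}`), `sum_indicator_grad_eq_zero` (telescoping along
`μ₀`-lines), `card_dir_bonds` (`#{b : dir b = μ₀} = |T^{(j)}|`), `sq_re_entry_le_norm_sq`.  §2 ★★★ `letter_floor_linAvg_dir`, `sum_norm_sq_dirDatum` (`Σ_c‖v c‖² = |T^{(j+1)}|`), ★★ `letter_floor_linAvg_rightInverse`.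

HONEST FRAMING.  A lower bound for ONE datum at the FLAT configuration, one level, whole torus; nothing of Bałaban's asserted; N12 ∕ N10 NOT discharged; K1⁹ NOT closed; count-neutral (typed
28∕28 · discharged 5∕27 unmoved); one finite 𝕋⁴ programme at fixed ε — R4 closes the conditional finite-𝕋⁴ rung `BalabanLadder.UV` only; the YM mass gap (Clay) is NOT proved by any of this;
nothing continuum ∕ ℝ⁴ ∕ OS.
-/

noncomputable section
open scoped BigOperators Matrix.Norms.L2Operator
open Finset
namespace Summit.QuantumFields.YangMills.BalabanUVNodes.N12FlatLinAvgLetterFloor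

open Literature.MathematicalPhysics.QuantumFieldTheory.Balaban1983to89
open LatticeFieldCalculus (bondAvg)
open BlockAveragingEMLLinearised (linAvg combMean linAvg_eq_bondAvg_sub_grad_combMean)
open B10StarCount (shiftEquiv)
open MatrixNorms (sum_norm_sq_col_le_opNorm_sq)
open Literature.MathematicalPhysics.QuantumFieldTheory.BalabanImbrieJaffe1984to88.BIJ85GaugeFunction5113 (exists_blockSite_eq)
open Summit.QuantumFields.YangMills.Theorems.Prop7FlatCurlCurl (sum_bond_eq_sum_site_dir)
open Summit.QuantumFields.YangMills.Theorems.Prop7TrueLinLineBound (sum_site_eq_sum_blockSite)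
open Summit.QuantumFields.YangMills.BalabanUVNodes.N12FlatOneLevelGramRightInverse (bondAvg_eq_sum_kernel)
open Summit.QuantumFields.YangMills.BalabanUVNodes.N12FlatOneLevelGramExact (sum_kernel_mul_eq)
open Summit.QuantumFields.YangMills.BalabanUVNodes.N12FlatLinAvgRightInverseUniform (re_bondAvg_entry)

variable {P : Params} {j : ℕ} {n : Type*} [Fintype n] [DecidableEq n]

/-! ## §1  The tent kernel against the indicator of one direction; telescoping; counting -/

section Pieces

omit [Fintype n] [DecidableEq n] in
/-- **`Qᵗ𝟙_{dir = μ₀} = L^{−d}·𝟙_{dir = μ₀}`**: the transpose kernel of the straight average (module H8's tent) sums the indicator of the coarse `μ₀`-bonds to `L^{−(d+1)}·((r_μ+1) + (L−1−r_μ)) = L^{−d}`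
on every fine `μ₀`-bond and to `0` on the others. [cite: Balaban1984PropagatorsI, (1.11) p.19] -/
theorem sum_kernel_indicator_dir [DecidableEq (PBond P j)] (hj : j + 1 ≤ P.m + P.K) (μ₀ : Fin P.d) (b : PBond P j) :
    ∑ c : PBond P (j + 1), bondAvg (Pi.single b (1 : ℝ)) c * (if c.dir = μ₀ then (1 : ℝ) else 0) = if b.dir = μ₀ then ((P.L : ℝ) ^ P.d)⁻¹ else 0 := by
  obtain ⟨r, hr⟩ := exists_blockSite_eq hj b.src
  have hb : b = ⟨Site.blockSite (blockOf b.src) r, b.dir⟩ := by cases b; simp only at hr ⊢; rw [hr]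
  rw [hb, sum_kernel_mul_eq hj (fun c : PBond P (j + 1) => if c.dir = μ₀ then (1 : ℝ) else 0) (blockOf b.src) r b.dir]
  have hL : (P.L : ℝ) ≠ 0 := Nat.cast_ne_zero.mpr P.L_pos.ne'
  simp only
  split_ifs with h
  · rw [pow_succ]; field_simp; ring
  · ring

/-- **The comb term telescopes against the indicator of one direction**: `Σ_c 𝟙_{dir c = μ₀}·(f(c₊) − f(c₋)) = Σ_y (f(y + e_{μ₀}) − f(y)) = 0`. [folklore] -/
theorem sum_indicator_grad_eq_zero {i : ℕ} (μ₀ : Fin P.d) (f : Site P i → ℝ) :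
    ∑ c : PBond P i, (if c.dir = μ₀ then (1 : ℝ) else 0) * (f c.tgt - f c.src) = 0 := by
  rw [sum_bond_eq_sum_site_dir]
  have h1 : ∀ x : Site P i, ∑ μ : Fin P.d, (if (⟨x, μ⟩ : PBond P i).dir = μ₀ then (1 : ℝ) else 0) * (f (PBond.tgt ⟨x, μ⟩) - f (PBond.src ⟨x, μ⟩)) = f (x.shift μ₀) - f x := by
    intro x
    simp only [PBond.tgt]
    rw [Finset.sum_eq_single μ₀ (fun μ _ hμ => by rw [if_neg hμ, zero_mul]) (fun h => absurd (Finset.mem_univ _) h), if_pos rfl, one_mul]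
  simp only [h1, Finset.sum_sub_distrib]
  have h2 : ∑ x : Site P i, f (x.shift μ₀) = ∑ x, f x := Equiv.sum_comp (shiftEquiv μ₀) f
  rw [h2, sub_self]

/-- **The number of fine bonds of one direction is the number of fine sites** (`= L^d·|T^{(j+1)}|` in the standing range). [folklore] -/
theorem sum_indicator_dir_eq_card {i : ℕ} (μ₀ : Fin P.d) : ∑ b : PBond P i, (if b.dir = μ₀ then (1 : ℝ) else 0) = Fintype.card (Site P i) := by
  rw [sum_bond_eq_sum_site_dir]
  have h1 : ∀ x : Site P i, ∑ μ : Fin P.d, (if (⟨x, μ⟩ : PBond P i).dir = μ₀ then (1 : ℝ) else 0) = 1 := fun x => by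
    rw [Finset.sum_eq_single μ₀ (fun μ _ hμ => by rw [if_neg hμ]) (fun h => absurd (Finset.mem_univ _) h), if_pos rfl]
  simp only [h1, Finset.sum_const, Finset.card_univ, nsmul_eq_mul, mul_one]

/-- `re(A_{i₀i₀})² ≤ ‖A‖²` (an entry is bounded by the operator norm). [folklore] -/
theorem sq_re_entry_le_norm_sq (A : Matrix n n ℂ) (i₀ : n) : ((A i₀ i₀).re) ^ 2 ≤ ‖A‖ ^ 2 := by
  have h1 : ((A i₀ i₀).re) ^ 2 ≤ ‖A i₀ i₀‖ ^ 2 := by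
    rw [← sq_abs]; exact pow_le_pow_left₀ (abs_nonneg _) (Complex.abs_re_le_norm _) 2
  have h2 : ‖A i₀ i₀‖ ^ 2 ≤ ∑ i, ‖A i i₀‖ ^ 2 := Finset.single_le_sum (f := fun i => ‖A i i₀‖ ^ 2) (fun i _ => sq_nonneg _) (Finset.mem_univ i₀)
  exact h1.trans (h2.trans (sum_norm_sq_col_le_opNorm_sq A i₀))

end Pieces

/-! ## §2  The floor -/

section Floor

/-- ★★★ **THE LETTER FLOOR FOR THE TRUE ONE-STEP LINEARISATION**: if `linAvg Y = 𝟙_{dir = μ₀}·E₀` (`E₀ = single i₀ i₀ 1`, `j + 1 ≤ m + K`) then `L^d·|T^{(j+1)}| ≤ L²·Σ_b ‖Y(b)‖²` — with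
`Σ_c ‖v(c)‖² = |T^{(j+1)}|` (`sum_norm_sq_dirDatum`) this is `Σ_b‖Y(b)‖² ≥ L^{d−2}·Σ_c‖v(c)‖²`: module H12b's uniform letter is of the right order in `L`.
[cite: Balaban1985Variational, (44)-(46) p.285; Balaban1985Averaging, (124)-(125) p.36, (62) p.28] -/
theorem letter_floor_linAvg_dir (hj : j + 1 ≤ P.m + P.K) (μ₀ : Fin P.d) (i₀ : n) (Y : PBond P j → Matrix n n ℂ)
    (hY : ∀ c : PBond P (j + 1), linAvg Y c = if c.dir = μ₀ then Matrix.single i₀ i₀ (1 : ℂ) else 0) :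
    (P.L : ℝ) ^ P.d * Fintype.card (Site P (j + 1)) ≤ (P.L : ℝ) ^ 2 * ∑ b, ‖Y b‖ ^ 2 := by
  classical
  have hL : (0 : ℝ) < (P.L : ℝ) := Nat.cast_pos.mpr P.L_pos
  have hLd : (0 : ℝ) < (P.L : ℝ) ^ P.d := by positivity
  -- the indicator, the real component
  set w : PBond P (j + 1) → ℝ := fun c => if c.dir = μ₀ then (1 : ℝ) else 0 with hw
  set a : PBond P j → ℝ := fun b => (Y b i₀ i₀).re with ha
  -- Step 1: the real `(i₀,i₀)` component of the identity `linAvg Y = L•QY − dλ̄(Y)` at the datum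
  have hstep1 : ∀ c : PBond P (j + 1), (P.L : ℝ) * bondAvg a c - (((combMean Y c.tgt) i₀ i₀).re - ((combMean Y c.src) i₀ i₀).re) = w c := by
    intro c
    have h := hY c
    rw [linAvg_eq_bondAvg_sub_grad_combMean] at h
    have h2 := congrArg (fun M : Matrix n n ℂ => (M i₀ i₀).re) h
    simp only [Matrix.sub_apply, Matrix.smul_apply, smul_eq_mul, Complex.sub_re, Complex.mul_re, Complex.natCast_re, Complex.natCast_im, zero_mul, sub_zero,
      re_bondAvg_entry] at h2
    rw [h2]
    by_cases hc : c.dir = μ₀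
    · simp [hw, hc, Matrix.single_apply_same]
    · simp [hw, hc]
  -- Step 2: pair with the indicator
  have hstep2 : ∑ c, w c * ((P.L : ℝ) * bondAvg a c - (((combMean Y c.tgt) i₀ i₀).re - ((combMean Y c.src) i₀ i₀).re)) = Fintype.card (Site P (j + 1)) := by
    have h1 : ∀ c, w c * ((P.L : ℝ) * bondAvg a c - (((combMean Y c.tgt) i₀ i₀).re - ((combMean Y c.src) i₀ i₀).re)) = w c := fun c => by
      rw [hstep1 c]
      by_cases hc : c.dir = μ₀ <;> simp [hw, hc]
    simp only [h1]
    exact sum_indicator_dir_eq_card μ₀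
  -- Step 3: the comb term telescopes, the straight term is the transpose kernel
  have hcomb : ∑ c, w c * (((combMean Y c.tgt) i₀ i₀).re - ((combMean Y c.src) i₀ i₀).re) = 0 :=
    sum_indicator_grad_eq_zero μ₀ (fun y => ((combMean Y y) i₀ i₀).re)
  have hstraight : ∑ c, w c * ((P.L : ℝ) * bondAvg a c) = (P.L : ℝ) * (((P.L : ℝ) ^ P.d)⁻¹ * ∑ b, (if b.dir = μ₀ then (1 : ℝ) else 0) * a b) := by
    have h1 : ∀ c, w c * ((P.L : ℝ) * bondAvg a c) = (P.L : ℝ) * ∑ b, bondAvg (Pi.single b (1 : ℝ)) c * w c * a b := fun c => by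
      rw [bondAvg_eq_sum_kernel a c, Finset.mul_sum, Finset.mul_sum, Finset.mul_sum]
      exact Finset.sum_congr rfl fun b _ => by ring
    simp only [h1, ← Finset.mul_sum]
    congr 1
    rw [Finset.sum_comm]
    have h2 : ∀ b : PBond P j, ∑ c, bondAvg (Pi.single b (1 : ℝ)) c * w c * a b = (if b.dir = μ₀ then ((P.L : ℝ) ^ P.d)⁻¹ else 0) * a b := fun b => by
      rw [← Finset.sum_mul, sum_kernel_indicator_dir hj μ₀ b]
    simp only [h2, Finset.mul_sum]
    exact Finset.sum_congr rfl fun b _ => by split_ifs <;> ring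
  -- Step 4: `|T^{(j+1)}| = L^{1−d}·S`, `S = Σ_{dir b = μ₀} a b`
  set S : ℝ := ∑ b, (if b.dir = μ₀ then (1 : ℝ) else 0) * a b with hS
  have hcardS : (Fintype.card (Site P (j + 1)) : ℝ) = (P.L : ℝ) * (((P.L : ℝ) ^ P.d)⁻¹ * S) := by
    rw [← hstep2]
    have : ∀ c, w c * ((P.L : ℝ) * bondAvg a c - (((combMean Y c.tgt) i₀ i₀).re - ((combMean Y c.src) i₀ i₀).re)) =
        w c * ((P.L : ℝ) * bondAvg a c) - w c * (((combMean Y c.tgt) i₀ i₀).re - ((combMean Y c.src) i₀ i₀).re) := fun c => by ring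
    simp only [this, Finset.sum_sub_distrib, hcomb, sub_zero]
    exact hstraight
  -- Step 5: Cauchy–Schwarz `S² ≤ (#μ₀-bonds)·Σ a² ≤ L^d|T^{(j+1)}|·Σ‖Y‖²`
  have hCS : S ^ 2 ≤ (∑ b : PBond P j, (if b.dir = μ₀ then (1 : ℝ) else 0) ^ 2) * ∑ b, a b ^ 2 := Finset.sum_mul_sq_le_sq_mul_sq _ _ _
  have hind : ∑ b : PBond P j, (if b.dir = μ₀ then (1 : ℝ) else 0) ^ 2 = (P.L : ℝ) ^ P.d * Fintype.card (Site P (j + 1)) := by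
    have h1 : ∀ b : PBond P j, (if b.dir = μ₀ then (1 : ℝ) else 0) ^ 2 = if b.dir = μ₀ then (1 : ℝ) else 0 := fun b => by split_ifs <;> simp
    simp only [h1]
    rw [sum_indicator_dir_eq_card μ₀, Site.card_site_eq_mul_succ hj]
    push_cast
    ring
  have ha2 : ∑ b, a b ^ 2 ≤ ∑ b, ‖Y b‖ ^ 2 := Finset.sum_le_sum fun b _ => sq_re_entry_le_norm_sq (Y b) i₀
  -- assemble
  set C : ℝ := (Fintype.card (Site P (j + 1)) : ℝ) with hC
  set T : ℝ := ∑ b, ‖Y b‖ ^ 2 with hT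
  have hC0 : 0 < C := by rw [hC]; exact_mod_cast Fintype.card_pos
  have hT0 : 0 ≤ T := Finset.sum_nonneg fun b _ => sq_nonneg _
  have hS_eq : S = ((P.L : ℝ) ^ P.d) * C / P.L := by
    rw [hcardS]; field_simp
  have h1 : S ^ 2 ≤ ((P.L : ℝ) ^ P.d * C) * T := hCS.trans (by rw [hind]; exact mul_le_mul_of_nonneg_left ha2 (by positivity))
  rw [hS_eq] at h1
  -- `(L^d C / L)² ≤ L^d C T` ⇒ `L^d C ≤ L² T`
  have h2 : ((P.L : ℝ) ^ P.d * C) * ((P.L : ℝ) ^ P.d * C) ≤ ((P.L : ℝ) ^ P.d * C) * ((P.L : ℝ) ^ 2 * T) := by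
    have h3 : ((P.L : ℝ) ^ P.d * C / P.L) ^ 2 * (P.L : ℝ) ^ 2 = ((P.L : ℝ) ^ P.d * C) * ((P.L : ℝ) ^ P.d * C) := by
      field_simp
    nlinarith [h1, sq_nonneg (P.L : ℝ)]
  exact le_of_mul_le_mul_left h2 (by positivity)

/-- The datum of the floor has unit size per coarse `μ₀`-bond: `Σ_c ‖𝟙_{dir c = μ₀}·E₀‖² = |T^{(j+1)}|` (`‖single i₀ i₀ 1‖ = 1`). [folklore] -/
theorem sum_norm_sq_dirDatum {i : ℕ} (μ₀ : Fin P.d) (i₀ : n) :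
    ∑ c : PBond P i, ‖(if c.dir = μ₀ then Matrix.single i₀ i₀ (1 : ℂ) else 0)‖ ^ 2 = Fintype.card (Site P i) := by
  have hE : ‖(Matrix.single i₀ i₀ (1 : ℂ) : Matrix n n ℂ)‖ = 1 := by
    rw [← Matrix.diagonal_single, Matrix.l2_opNorm_diagonal, Pi.norm_single, norm_one]
  have h1 : ∀ c : PBond P i, ‖(if c.dir = μ₀ then Matrix.single i₀ i₀ (1 : ℂ) else 0)‖ ^ 2 = if c.dir = μ₀ then (1 : ℝ) else 0 := fun c => by
    split_ifs
    · rw [hE, one_pow]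
    · rw [norm_zero]; ring
  simp only [h1]
  exact sum_indicator_dir_eq_card μ₀

/-- ★★ **EVERY RIGHT INVERSE `R` OF `linAvg` COSTS AT LEAST `L^{d−2}` AT THE DATUM `v₀ = 𝟙_{dir = μ₀}·E_{i₀i₀}`**: `L^d·Σ_c ‖v₀(c)‖² ≤ L²·Σ_b ‖(R v₀)(b)‖²` — the companion of module H12b's
`exists_linAvg_rightInverse_uniform` (letter `≤ |n|(6L^d∕(L²+2) + 288d(d+2)²)·Σ‖v‖²`, of the same order `L^{d−2}`). [cite: Balaban1985Variational, (44)-(46) p.285; Balaban1985Averaging, (124)-(125) p.36] -/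
theorem letter_floor_linAvg_rightInverse (hj : j + 1 ≤ P.m + P.K) (R : (PBond P (j + 1) → Matrix n n ℂ) → (PBond P j → Matrix n n ℂ))
    (hR : ∀ v c, linAvg (R v) c = v c) (μ₀ : Fin P.d) (i₀ : n) :
    (P.L : ℝ) ^ P.d * ∑ c : PBond P (j + 1), ‖(if c.dir = μ₀ then Matrix.single i₀ i₀ (1 : ℂ) else (0 : Matrix n n ℂ))‖ ^ 2 ≤
      (P.L : ℝ) ^ 2 * ∑ b, ‖R (fun c => if c.dir = μ₀ then Matrix.single i₀ i₀ (1 : ℂ) else 0) b‖ ^ 2 := by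
  rw [sum_norm_sq_dirDatum μ₀ i₀]
  exact letter_floor_linAvg_dir hj μ₀ i₀ _ fun c => hR _ c

end Floor

end Summit.QuantumFields.YangMills.BalabanUVNodes.N12FlatLinAvgLetterFloor
end
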